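import Summits.ABC.IUTFork.Conditional.AbcOfSGenuineMSharpLevelCut
import Summits.ABC.IUTFork.Conditional.AbcOfSDegreeCutJunction
import HarnessLib

/-!
# Branch C «abc ⇐ S», M line: the θ-window RECORD and its STABLE COMPANION with EVERY cuttable binder cut — the number binders at the SHARP
# LEVEL of abc-triple Frey points (file 3, p511567) AND the CONE / NUM-1.10 binders at DEGREE `d_mod ≥ 2` (abc-iut cell, branch C, sequel
# «DEGREE CUT» to row «C-LEVELCUT-SHARP», M file; seat abc-iut-C-cert-2 gen 7)

Record-only PROOF file (D-0012; 0 definitions, 0 `Prop` facts, nothing re-typed; the M books' DATA block and binder texts VERBATIM) of the abc-iut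
cell. TAKES NO SIDE on [IUTchIII] Cor. 3.12, on [IUTchIV] Thm. 1.10, on (U)/(P), or on any author. The junctions are `AbcOfSDegreeCutJunction`
(`DegCut.hregC_of_degCut`, `DegCut.hSqMixC_of_degCut`; the CONE and NUM-1.10 binder texts are the K line's, letter for letter):

* **`abc_of_SH_v11M_window_content_sharpDegreeCut`** — the M RECORD p461893 with [S_H, M setting] `hSHwC` VERBATIM (uncut: no M-setting
  eventual licence in the tree) · [NUM, window + sharp cut] `hNumCWS` · [CONE, `d_mod ≥ 2`] `hregCD`; explicit 3 — UNCHANGED;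
* **`abc_of_SH_orNum_M_mix_content_sharpDegreeCut`** — the M STABLE COMPANION p461892 with [NUM-OFF-M, window + sharp cut] `hNumOffCWS` ·
  [NUM-1.10, `d_mod ≥ 2`] `hSqMixCD`; explicit 2 — UNCHANGED.

WORDS (numbers, not adjectives): at every point of degree one the M stable companion assumes ONLY «¬S_H,M ⇒ T.Cor312Of» on the content locus,
and at the Frey point of an abc triple with `j ≠ 1728` only at primes `l ≤ 4·√(abc) + 4` with `l ≤ max p (4·p^{⌊v_p(abc)/2⌋})` for some odd bad
`p`; the M record assumes there S_H,M (uncut) and the number-level Corollary (cut). A cut discharges nothing; counts unchanged. «`ABC` follows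
from these hypotheses as typed» — typed ≠ proved; instantiated ≠ endorsed; no abc claim. [cite: Mochizuki2012, IUTchIII Cor. 3.12 p. 173–174,
Step (xi-f) p. 184; IUTchIV Thm. 1.10 p. 22–24, Steps (v) p. 27–28, (viii) p. 30, Cor. 2.2 (ii) p. 44–46] [cite: DupuyHilado2025, §3.6, §4.9,
§4.12] [claim: Mochizuki2012, status: disputed] for every IUT quotation.
-/

noncomputable section

open Set Function NumberField IsDedekindDomain

namespace Summit.ABC.IUTFork.Conditional

open Thm311 Thm311.Real Cor312 Cor312Vol Cor312Prov Literature.IUT.LogThetaLattice Literature.IUT.LogVolume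
  Literature.IUT.HodgeTheaters Literature.IUT.LogVolume.ThetaData Literature.IUT.LogVolume.Cor22
open Literature.NumberTheory.NumberFields Literature.NumberTheory.GaloisRepresentations.Ultrametric
open Literature.NumberTheory.DiophantineGeometry Literature.NumberTheory.DiophantineGeometry.GenEll Summit.ABC.ABC.Theorems
open scoped Classical

section FamilyM

/-! ## §0. DATA — the M books' per-datum context and column binders, VERBATIM as p461893 / p461892 -/

variable
    (M : ∀ (P : NFPoint) (l : ℕ) (T : Cor22.ThetaVolumeDatumAt P l), Type) [∀ P l T, Field (M P l T)] [∀ P l T, NumberField (M P l T)]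
    (archPk : ∀ (P : NFPoint) (l : ℕ) (T : Cor22.ThetaVolumeDatumAt P l), letI := T.instFieldF; letI := T.instNumberFieldF; letI := T.instAlgebraF; letI := T.instFieldK;
        letI := T.instNumberFieldK; letI := T.instAlgebraK; letI := T.instFieldFbar; letI := T.instAlgebraFbar;
        letI := T.instAlgebraKFbar; letI := T.instIsElliptic;
      ∀ (j : (thetaIndexOfInitial T.D).Label) (vQ : (thetaIndexOfInitial T.D).VQ), Set ((logShellsOfInitialDH T.D (analyticLogvVal T.K)).Packet j vQ))
    (archSub : ∀ (P : NFPoint) (l : ℕ) (T : Cor22.ThetaVolumeDatumAt P l), letI := T.instFieldF; letI := T.instNumberFieldF; letI := T.instAlgebraF; letI := T.instFieldK;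
        letI := T.instNumberFieldK; letI := T.instAlgebraK; letI := T.instFieldFbar; letI := T.instAlgebraFbar;
        letI := T.instAlgebraKFbar; letI := T.instIsElliptic;
      ∀ (j : (thetaIndexOfInitial T.D).Label) (v : (thetaIndexOfInitial T.D).V), Set ((logShellsOfInitialDH T.D (analyticLogvVal T.K)).Packet j ((thetaIndexOfInitial T.D).over v)))
    (Ψ : ∀ (P : NFPoint) (l : ℕ) (T : Cor22.ThetaVolumeDatumAt P l), letI := T.instFieldF; letI := T.instNumberFieldF; letI := T.instAlgebraF; letI := T.instFieldK;
        letI := T.instNumberFieldK; letI := T.instAlgebraK; letI := T.instFieldFbar; letI := T.instAlgebraFbar;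
        letI := T.instAlgebraKFbar; letI := T.instIsElliptic;
      ℤ → ∀ v : (thetaIndexOfInitial T.D).V, v ∈ (thetaIndexOfInitial T.D).Vbad → Set ((logShellsOfInitialDH T.D (analyticLogvVal T.K)).StarPacket v))
    (act : ∀ (P : NFPoint) (l : ℕ) (T : Cor22.ThetaVolumeDatumAt P l), letI := T.instFieldF; letI := T.instNumberFieldF; letI := T.instAlgebraF; letI := T.instFieldK;
        letI := T.instNumberFieldK; letI := T.instAlgebraK; letI := T.instFieldFbar; letI := T.instAlgebraFbar;
        letI := T.instAlgebraKFbar; letI := T.instIsElliptic;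
      ℤ → ∀ v : (thetaIndexOfInitial T.D).V, v ∈ (thetaIndexOfInitial T.D).Vbad → (logShellsOfInitialDH T.D (analyticLogvVal T.K)).StarPacket v → Module.End ℚ ((logShellsOfInitialDH T.D (analyticLogvVal T.K)).StarPacket v))
    (Mmod : ∀ (P : NFPoint) (l : ℕ) (T : Cor22.ThetaVolumeDatumAt P l), letI := T.instFieldF; letI := T.instNumberFieldF; letI := T.instAlgebraF; letI := T.instFieldK;
        letI := T.instNumberFieldK; letI := T.instAlgebraK; letI := T.instFieldFbar; letI := T.instAlgebraFbar;
        letI := T.instAlgebraKFbar; letI := T.instIsElliptic;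
      ℤ → ∀ j : (thetaIndexOfInitial T.D).LabelStar, Set ((logShellsOfInitialDH T.D (analyticLogvVal T.K)).GlobalPacket j.1))
    (region : ∀ (P : NFPoint) (l : ℕ) (T : Cor22.ThetaVolumeDatumAt P l), letI := T.instFieldF; letI := T.instNumberFieldF; letI := T.instAlgebraF; letI := T.instFieldK;
        letI := T.instNumberFieldK; letI := T.instAlgebraK; letI := T.instFieldFbar; letI := T.instAlgebraFbar;
        letI := T.instAlgebraKFbar; letI := T.instIsElliptic;
      ℤ → ∀ j : (thetaIndexOfInitial T.D).LabelStar, FinDivisor (M P l T) → ∀ vQ : (thetaIndexOfInitial T.D).VQ, Set ((logShellsOfInitialDH T.D (analyticLogvVal T.K)).Packet j.1 vQ))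
    (frobAdm : ∀ (P : NFPoint) (l : ℕ) (T : Cor22.ThetaVolumeDatumAt P l), letI := T.instFieldF; letI := T.instNumberFieldF; letI := T.instAlgebraF; letI := T.instFieldK;
        letI := T.instNumberFieldK; letI := T.instAlgebraK; letI := T.instFieldFbar; letI := T.instAlgebraFbar;
        letI := T.instAlgebraKFbar; letI := T.instIsElliptic;
      ℤ → ℤ → ∀ (j : (thetaIndexOfInitial T.D).Label) (vQ : (thetaIndexOfInitial T.D).VQ), Set ((logShellsOfInitialDH T.D (analyticLogvVal T.K)).Packet j vQ) → Prop)
    (frobLogvol : ∀ (P : NFPoint) (l : ℕ) (T : Cor22.ThetaVolumeDatumAt P l), letI := T.instFieldF; letI := T.instNumberFieldF; letI := T.instAlgebraF; letI := T.instFieldK;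
        letI := T.instNumberFieldK; letI := T.instAlgebraK; letI := T.instFieldFbar; letI := T.instAlgebraFbar;
        letI := T.instAlgebraKFbar; letI := T.instIsElliptic;
      ℤ → ℤ → ∀ (j : (thetaIndexOfInitial T.D).Label) (vQ : (thetaIndexOfInitial T.D).VQ), Set ((logShellsOfInitialDH T.D (analyticLogvVal T.K)).Packet j vQ) → ℝ)
    (frobΨ : ∀ (P : NFPoint) (l : ℕ) (T : Cor22.ThetaVolumeDatumAt P l), letI := T.instFieldF; letI := T.instNumberFieldF; letI := T.instAlgebraF; letI := T.instFieldK;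
        letI := T.instNumberFieldK; letI := T.instAlgebraK; letI := T.instFieldFbar; letI := T.instAlgebraFbar;
        letI := T.instAlgebraKFbar; letI := T.instIsElliptic;
      ℤ → ℤ → ∀ v : (thetaIndexOfInitial T.D).V, v ∈ (thetaIndexOfInitial T.D).Vbad → Set ((logShellsOfInitialDH T.D (analyticLogvVal T.K)).StarPacket v))
    (frobMmod : ∀ (P : NFPoint) (l : ℕ) (T : Cor22.ThetaVolumeDatumAt P l), letI := T.instFieldF; letI := T.instNumberFieldF; letI := T.instAlgebraF; letI := T.instFieldK;
        letI := T.instNumberFieldK; letI := T.instAlgebraK; letI := T.instFieldFbar; letI := T.instAlgebraFbar;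
        letI := T.instAlgebraKFbar; letI := T.instIsElliptic;
      ℤ → ℤ → ∀ j : (thetaIndexOfInitial T.D).LabelStar, Set ((logShellsOfInitialDH T.D (analyticLogvVal T.K)).GlobalPacket j.1))
    (unitImage : ∀ (P : NFPoint) (l : ℕ) (T : Cor22.ThetaVolumeDatumAt P l), letI := T.instFieldF; letI := T.instNumberFieldF; letI := T.instAlgebraF; letI := T.instFieldK;
        letI := T.instNumberFieldK; letI := T.instAlgebraK; letI := T.instFieldFbar; letI := T.instAlgebraFbar;
        letI := T.instAlgebraKFbar; letI := T.instIsElliptic;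
      ℤ → ℤ → ℕ → ∀ (j : (thetaIndexOfInitial T.D).Label) (vQ : (thetaIndexOfInitial T.D).VQ), Set ((logShellsOfInitialDH T.D (analyticLogvVal T.K)).Packet j vQ))
    (ballImage : ∀ (P : NFPoint) (l : ℕ) (T : Cor22.ThetaVolumeDatumAt P l), letI := T.instFieldF; letI := T.instNumberFieldF; letI := T.instAlgebraF; letI := T.instFieldK;
        letI := T.instNumberFieldK; letI := T.instAlgebraK; letI := T.instFieldFbar; letI := T.instAlgebraFbar;
        letI := T.instAlgebraKFbar; letI := T.instIsElliptic;
      ℤ → ℤ → ∀ (j : (thetaIndexOfInitial T.D).Label) (vQ : (thetaIndexOfInitial T.D).VQ), Set ((logShellsOfInitialDH T.D (analyticLogvVal T.K)).Packet j vQ))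
    (thetaDiv : ∀ (P : NFPoint) (l : ℕ) (T : Cor22.ThetaVolumeDatumAt P l), letI := T.instFieldF; letI := T.instNumberFieldF; letI := T.instAlgebraF; letI := T.instFieldK;
        letI := T.instNumberFieldK; letI := T.instAlgebraK; letI := T.instFieldFbar; letI := T.instAlgebraFbar;
        letI := T.instAlgebraKFbar; letI := T.instIsElliptic;
      ℤ → ℤ → LgpDivisor (M P l T) (thetaIndexOfInitial T.D).lstar)
    (n : ∀ (P : NFPoint) (l : ℕ) (T : Cor22.ThetaVolumeDatumAt P l), ℤ)
    {HT : ∀ (P : NFPoint) (l : ℕ) (T : Cor22.ThetaVolumeDatumAt P l), Type} {LogLink : ∀ (P : NFPoint) (l : ℕ) (T : Cor22.ThetaVolumeDatumAt P l), HT P l T → HT P l T → Type}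
    {IsFull : ∀ (P : NFPoint) (l : ℕ) (T : Cor22.ThetaVolumeDatumAt P l), ∀ {s t : HT P l T}, LogLink P l T s t → Prop}
    (lat : ∀ (P : NFPoint) (l : ℕ) (T : Cor22.ThetaVolumeDatumAt P l), LGPGaussianLogThetaLattice (LogLink P l T) (IsFull P l T))
    {Frd : ∀ (P : NFPoint) (l : ℕ) (T : Cor22.ThetaVolumeDatumAt P l), Type} {IsoF : ∀ (P : NFPoint) (l : ℕ) (T : Cor22.ThetaVolumeDatumAt P l), Frd P l T → Frd P l T → Type} {Ob : ∀ (P : NFPoint) (l : ℕ) (T : Cor22.ThetaVolumeDatumAt P l), Frd P l T → Type}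
    {realify : ∀ (P : NFPoint) (l : ℕ) (T : Cor22.ThetaVolumeDatumAt P l), Frd P l T → Frd P l T} {Strip : ∀ (P : NFPoint) (l : ℕ) (T : Cor22.ThetaVolumeDatumAt P l), Type} {IsoS : ∀ (P : NFPoint) (l : ℕ) (T : Cor22.ThetaVolumeDatumAt P l), Strip P l T → Strip P l T → Type}
    {Mv : ∀ (P : NFPoint) (l : ℕ) (T : Cor22.ThetaVolumeDatumAt P l), letI := T.instFieldF; letI := T.instNumberFieldF; letI := T.instAlgebraF; letI := T.instFieldK;
        letI := T.instNumberFieldK; letI := T.instAlgebraK; letI := T.instFieldFbar; letI := T.instAlgebraFbar;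
        letI := T.instAlgebraKFbar; letI := T.instIsElliptic;
      ∀ v : (thetaIndexOfInitial T.D).V, v ∈ (thetaIndexOfInitial T.D).Vbad → Type}
    [∀ P l T v h, Monoid (Mv P l T v h)]
    (sig : ∀ (P : NFPoint) (l : ℕ) (T : Cor22.ThetaVolumeDatumAt P l), letI := T.instFieldF; letI := T.instNumberFieldF; letI := T.instAlgebraF; letI := T.instFieldK;
        letI := T.instNumberFieldK; letI := T.instAlgebraK; letI := T.instFieldFbar; letI := T.instAlgebraFbar;
        letI := T.instAlgebraKFbar; letI := T.instIsElliptic;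
      GlobalLGPFrobenioidSignature (thetaIndexOfInitial T.D).lstar (thetaIndexOfInitial T.D).V (· ∈ (thetaIndexOfInitial T.D).Vbad) (Frd P l T) (IsoF P l T) (Ob P l T) (realify P l T)
        (Strip P l T) (IsoS P l T) (Mv P l T))
    (split : ∀ (P : NFPoint) (l : ℕ) (T : Cor22.ThetaVolumeDatumAt P l), SplittingMonoids (Mv P l T))
    {ObΔ : ∀ (P : NFPoint) (l : ℕ) (T : Cor22.ThetaVolumeDatumAt P l), Type}
    {N : ∀ (P : NFPoint) (l : ℕ) (T : Cor22.ThetaVolumeDatumAt P l), letI := T.instFieldF; letI := T.instNumberFieldF; letI := T.instAlgebraF; letI := T.instFieldK;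
        letI := T.instNumberFieldK; letI := T.instAlgebraK; letI := T.instFieldFbar; letI := T.instAlgebraFbar;
        letI := T.instAlgebraKFbar; letI := T.instIsElliptic;
      ∀ v : (thetaIndexOfInitial T.D).V, v ∈ (thetaIndexOfInitial T.D).Vbad → Type}
    [∀ P l T v h, Monoid (N P l T v h)] (qData : ∀ (P : NFPoint) (l : ℕ) (T : Cor22.ThetaVolumeDatumAt P l), QPilotData (ObΔ P l T) (N P l T))
    (qK : ∀ (P : NFPoint) (l : ℕ) (T : Cor22.ThetaVolumeDatumAt P l), letI := T.instFieldF; letI := T.instNumberFieldF; letI := T.instAlgebraF; letI := T.instFieldK;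
        letI := T.instNumberFieldK; letI := T.instAlgebraK; letI := T.instFieldFbar; letI := T.instAlgebraFbar;
        letI := T.instAlgebraKFbar; letI := T.instIsElliptic;
      ∀ v : (thetaIndexOfInitial T.D).V, v ∈ (thetaIndexOfInitial T.D).Vbad → Set ((logShellsOfInitialDH T.D (analyticLogvVal T.K)).StarPacket v))

/-! ## §1. The M record: sharp level cut + degree cut -/

/-- **`abc_of_SH_v11M_window_content_sharpDegreeCut`** — the M-line RECORD `abc_of_SH_v11M_window_content` (p461893) with [S_H, M setting]
`hSHwC` (VERBATIM) · [NUM, window + sharp cut] `hNumCWS` · [CONE, `d_mod ≥ 2`] `hregCD`. Proof: file 3's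
`abc_of_SH_v11M_window_content_sharpLevelCut` (p511567) with `DegCut.hregC_of_degCut`. Explicit 3 — UNCHANGED (cuts). «`ABC` follows from these
hypotheses as typed» — no side taken; typed ≠ proved. [claim: Mochizuki2012, status: disputed] [cite: Mochizuki2012, IUTchIII Cor. 3.12
Step (xi-f) p. 184; IUTchIV Thm. 1.10 Steps (v), (viii) p. 27–30] -/
theorem abc_of_SH_v11M_window_content_sharpDegreeCut
    -- [S_H, WINDOW, content] v11M's hSHw under the display-content antecedent (implies the Szpiro-bad one: `szpiroBad_of_content`)
    (hSHwC : ∀ (P : NFPoint), P ∈ UP → ∀ (l : ℕ), l.Prime → 5 ≤ l →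
      Cor22.AdmitsCore P → Cor22.CondP2 P l → Cor22.CondP5 P l → Cor22.CondP6 P l →
      6 * ((1 + 20 * (Cor22.dmod P : ℝ) / l) * (P.logDiff + Cor22.logCondAvoid P {2, l}))
          + 120 * (2 ^ 12 * 3 ^ 3 * 5 * (Cor22.dmod P : ℝ) * l) < Cor22.logQAvoid P {2, l} →
      ∀ (T : Cor22.ThetaVolumeDatumAt P l), letI := T.instFieldF; letI := T.instNumberFieldF; letI := T.instAlgebraF; letI := T.instFieldK;
        letI := T.instNumberFieldK; letI := T.instAlgebraK; letI := T.instFieldFbar; letI := T.instAlgebraFbar;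
        letI := T.instAlgebraKFbar; letI := T.instIsElliptic;
      (¬ ∃ (u : FinitePlace ℚ) (i : Fin (thetaIndexOfInitial T.D).lstar) (x₀ : (thetaIndexOfInitial T.D).Fibre (Val.non u)),
        ((ratChar u : ℕ) : ℝ) ^ ((((i : ℕ) : ℝ) + 2) *
        (differentOrd (ratChar u) (kOfM T.D (ratChar u) u (natCast_ratChar_mem u) x₀)
        + logRadiusA (ratChar u) (absRamificationIdx (ratChar u) (kOfM T.D (ratChar u) u (natCast_ratChar_mem u) x₀))
        + logRadiusB (ratChar u) (absRamificationIdx (ratChar u) (kOfM T.D (ratChar u) u (natCast_ratChar_mem u) x₀))) + 1) *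
        ‖tqM T.D (ratChar u) u (natCast_ratChar_mem u) (ideleDataOf T.D T.isVolumeInputOf) x₀‖ ^ (((i : ℕ) + 1) ^ 2 - 1) < 1) →
      Cor312Vol.PilotKummerCompatHull
        (LatticeSituation.ofShells (logShellsOfInitialDH T.D (analyticLogvVal T.K)) (M P l T) (archPk P l T) (archSub P l T)
          (summandPiecesPrM T.D (logvAnalyticVal_analyticLogvVal (K := T.K))).Adm
          (summandPiecesPrM T.D (logvAnalyticVal_analyticLogvVal (K := T.K))).logvol (Ψ P l T) (act P l T) (Mmod P l T)
          (region P l T) (frobAdm P l T) (frobLogvol P l T) (frobΨ P l T) (frobMmod P l T) (unitImage P l T) (ballImage P l T)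
          (thetaDiv P l T))
        (settingPrVolSharpM T.D (logvAnalyticVal_analyticLogvVal (K := T.K)) (tOfIdeleData T.D (ideleDataOf T.D T.isVolumeInputOf))
          (fun u x => tqM T.D (ratChar u) u (natCast_ratChar_mem u) (ideleDataOf T.D T.isVolumeInputOf) x)
          (M P l T) (archPk P l T) (archSub P l T) (Ψ P l T) (act P l T)
          (Mmod P l T) (region P l T) (n P l T) (lat P l T) (sig P l T) (split P l T) (qData P l T)
          (fun u x => tqM_ne_zero T.D (ratChar u) u (natCast_ratChar_mem u) (ideleDataOf T.D T.isVolumeInputOf) x)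
          (GenuineM.finite_ratPlaces_under_S T.D).toFinset
          (fun u x hu => norm_tqM_eq_one_of_not_mem T.D (ratChar u) u (natCast_ratChar_mem u) (ideleDataOf T.D T.isVolumeInputOf) x
            fun hx => hu ((Set.Finite.mem_toFinset _).mpr ⟨x, hx⟩))) 
        (fun _ => Cor312.Setting.qRegion
        (settingPrVolSharpM T.D (logvAnalyticVal_analyticLogvVal (K := T.K)) (tOfIdeleData T.D (ideleDataOf T.D T.isVolumeInputOf))
          (fun u x => tqM T.D (ratChar u) u (natCast_ratChar_mem u) (ideleDataOf T.D T.isVolumeInputOf) x)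
          (M P l T) (archPk P l T) (archSub P l T) (Ψ P l T) (act P l T)
          (Mmod P l T) (region P l T) (n P l T) (lat P l T) (sig P l T) (split P l T) (qData P l T)
          (fun u x => tqM_ne_zero T.D (ratChar u) u (natCast_ratChar_mem u) (ideleDataOf T.D T.isVolumeInputOf) x)
          (GenuineM.finite_ratPlaces_under_S T.D).toFinset
          (fun u x hu => norm_tqM_eq_one_of_not_mem T.D (ratChar u) u (natCast_ratChar_mem u) (ideleDataOf T.D T.isVolumeInputOf) x
            fun hx => hu ((Set.Finite.mem_toFinset _).mpr ⟨x, hx⟩)))) (qK P l T))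
    -- [NUM, DEEP, content] v11M's hNum under the display-content antecedent
    (hNumCWS : ∀ (P : NFPoint), P ∈ UP → ∀ (l : ℕ), l.Prime → 5 ≤ l →
      l < max (max 5 (8 * P.degree)) ⌈Real.exp (2 / 3 * (P.degree : ℝ) * Cor22.logQAvoid P {2})⌉₊ →
      -- SHARP LEVEL CUT (p508140): if `P` is the Frey point of an abc triple (`j ≠ 1728`), ONLY at primes `l ≤ 4·√(abc) + 4` with `l ≤ max p (4·p^{⌊v_p(abc)/2⌋})` for some odd bad `p`
      (∀ a b c : ℕ, IsABCTriple a b c → Cor22.jInv ((a : ℚ) / c) ≠ 1728 → P = ratPoint ((a : ℚ) / c) →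
        l ≤ 4 * Nat.sqrt (a * b * c) + 4 ∧
          ∃ p : ℕ, p.Prime ∧ p ∣ a * b * c ∧ p ≠ 2 ∧ l ≤ max p (4 * p ^ ((a * b * c).factorization p / 2))) →
      Cor22.AdmitsCore P → Cor22.CondP2 P l → Cor22.CondP5 P l → Cor22.CondP6 P l →
      6 * ((1 + 20 * (Cor22.dmod P : ℝ) / l) * (P.logDiff + Cor22.logCondAvoid P {2, l}))
          + 120 * (2 ^ 12 * 3 ^ 3 * 5 * (Cor22.dmod P : ℝ) * l) < Cor22.logQAvoid P {2, l} →
      ∀ (T : Cor22.ThetaVolumeDatumAt P l), letI := T.instFieldF; letI := T.instNumberFieldF; letI := T.instAlgebraF; letI := T.instFieldK;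
        letI := T.instNumberFieldK; letI := T.instAlgebraK; letI := T.instFieldFbar; letI := T.instAlgebraFbar;
        letI := T.instAlgebraKFbar; letI := T.instIsElliptic;
      (∃ (u : FinitePlace ℚ) (i : Fin (thetaIndexOfInitial T.D).lstar) (x₀ : (thetaIndexOfInitial T.D).Fibre (Val.non u)),
        ((ratChar u : ℕ) : ℝ) ^ ((((i : ℕ) : ℝ) + 2) *
        (differentOrd (ratChar u) (kOfM T.D (ratChar u) u (natCast_ratChar_mem u) x₀)
        + logRadiusA (ratChar u) (absRamificationIdx (ratChar u) (kOfM T.D (ratChar u) u (natCast_ratChar_mem u) x₀))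
        + logRadiusB (ratChar u) (absRamificationIdx (ratChar u) (kOfM T.D (ratChar u) u (natCast_ratChar_mem u) x₀))) + 1) *
        ‖tqM T.D (ratChar u) u (natCast_ratChar_mem u) (ideleDataOf T.D T.isVolumeInputOf) x₀‖ ^ (((i : ℕ) + 1) ^ 2 - 1) < 1) → T.Cor312Of)
    -- [CONE, content] hregBad (C-R28 (3)(α)) under the display-content antecedent
    (hregCD : ∀ P : NFPoint, P ∈ UP → ∀ l : ℕ, l.Prime → 5 ≤ l →
      -- DEGREE CUT: ONLY at points with `d_mod ≥ 2` — at `d_mod = 1` (`F_mod = ℚ`: ONE place over each prime) every datum is slot-constant and no prime is mixed, so the antecedent below is void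
      2 ≤ Cor22.dmod P →
      Cor22.AdmitsCore P → Cor22.CondP2 P l → Cor22.CondP5 P l → Cor22.CondP6 P l →
      6 * ((1 + 20 * (Cor22.dmod P : ℝ) / l) * (P.logDiff + Cor22.logCondAvoid P {2, l}))
          + 120 * (2 ^ 12 * 3 ^ 3 * 5 * (Cor22.dmod P : ℝ) * l) < Cor22.logQAvoid P {2, l} →
      ∀ T : Cor22.ThetaVolumeDatumAt P l,
        (letI := T.instFieldF; letI := T.instNumberFieldF; letI := T.instAlgebraF; letI := T.instFieldK
         letI := T.instNumberFieldK; letI := T.instAlgebraK; letI := T.instFieldFbar; letI := T.instAlgebraFbar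
         letI := T.instAlgebraKFbar; letI := T.instIsElliptic
         ¬ (∀ p ∈ T.I.supportPrimes, ∀ v w : placesOver (fieldOfModuli T.E) p,
            (Summit.ABC.IUTFork.DHData.ofInput T.I).logQloc p v = (Summit.ABC.IUTFork.DHData.ofInput T.I).logQloc p w)) →
        T.HullEstimateOf
          (((l : ℝ) + 1) / 4 *
            ((1 + 12 * (Cor22.dmod P : ℝ) / l) * (P.logDiff + Cor22.logCondAvoid P {2, l})
              + 2 * Real.log l + 52
              + 20 / 3 * Real.log (((2 ^ 12 * 3 ^ 3 * 5 * Cor22.dmod P : ℕ) : ℝ) * (l : ℝ))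
                * (Nat.primeCounting (2 ^ 12 * 3 ^ 3 * 5 * Cor22.dmod P * l) : ℝ))))
    : _root_.ABC :=
  abc_of_SH_v11M_window_content_sharpLevelCut M archPk archSub Ψ act Mmod region frobAdm frobLogvol frobΨ frobMmod unitImage ballImage thetaDiv n lat sig split qData qK hSHwC hNumCWS (DegCut.hregC_of_degCut hregCD)

/-! ## §2. The M stable companion: sharp level cut + degree cut -/

/-- **`abc_of_SH_orNum_M_mix_content_sharpDegreeCut`** — the M-line STABLE COMPANION `abc_of_SH_orNum_M_mix_content` (p461892) with
[NUM-OFF-M, window + sharp cut] `hNumOffCWS` · [NUM-1.10, `d_mod ≥ 2`] `hSqMixCD`. Proof: file 3's `abc_of_SH_orNum_M_mix_content_sharpLevelCut`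
with `DegCut.hSqMixC_of_degCut`. Explicit 2 — UNCHANGED (cuts). «`ABC` follows from these hypotheses as typed» — no side taken; typed ≠ proved.
[claim: Mochizuki2012, status: disputed] [cite: Mochizuki2012, IUTchIII Cor. 3.12 Step (xi-f) p. 184; IUTchIV Thm. 1.10 Step (viii) p. 30] -/
theorem abc_of_SH_orNum_M_mix_content_sharpDegreeCut
    -- [NUM-OFF, content] at admissible (P,l) ON THE CONTENT LOCUS of [IUTchIV] Thm 1.10's display, at every genuine datum where OUR typed licence FAILS at the M setting of its OWN ideles: the number-level Corollary
    (hNumOffCWS : ∀ (P : NFPoint), P ∈ UP → ∀ (l : ℕ), l.Prime → 5 ≤ l →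
      l < max (max 5 (8 * P.degree)) ⌈Real.exp (2 / 3 * (P.degree : ℝ) * Cor22.logQAvoid P {2})⌉₊ →
      -- SHARP LEVEL CUT (p508140): if `P` is the Frey point of an abc triple (`j ≠ 1728`), ONLY at primes `l ≤ 4·√(abc) + 4` with `l ≤ max p (4·p^{⌊v_p(abc)/2⌋})` for some odd bad `p`
      (∀ a b c : ℕ, IsABCTriple a b c → Cor22.jInv ((a : ℚ) / c) ≠ 1728 → P = ratPoint ((a : ℚ) / c) →
        l ≤ 4 * Nat.sqrt (a * b * c) + 4 ∧
          ∃ p : ℕ, p.Prime ∧ p ∣ a * b * c ∧ p ≠ 2 ∧ l ≤ max p (4 * p ^ ((a * b * c).factorization p / 2))) →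
      Cor22.AdmitsCore P → Cor22.CondP2 P l → Cor22.CondP5 P l → Cor22.CondP6 P l →
      6 * ((1 + 20 * (Cor22.dmod P : ℝ) / l) * (P.logDiff + Cor22.logCondAvoid P {2, l}))
          + 120 * (2 ^ 12 * 3 ^ 3 * 5 * (Cor22.dmod P : ℝ) * l) < Cor22.logQAvoid P {2, l} →
      ∀ (T : Cor22.ThetaVolumeDatumAt P l), letI := T.instFieldF; letI := T.instNumberFieldF; letI := T.instAlgebraF; letI := T.instFieldK;
        letI := T.instNumberFieldK; letI := T.instAlgebraK; letI := T.instFieldFbar; letI := T.instAlgebraFbar;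
        letI := T.instAlgebraKFbar; letI := T.instIsElliptic;
      ¬ (Cor312Vol.PilotKummerCompatHull
        (LatticeSituation.ofShells (logShellsOfInitialDH T.D (analyticLogvVal T.K)) (M P l T) (archPk P l T) (archSub P l T)
          (summandPiecesPrM T.D (logvAnalyticVal_analyticLogvVal (K := T.K))).Adm
          (summandPiecesPrM T.D (logvAnalyticVal_analyticLogvVal (K := T.K))).logvol (Ψ P l T) (act P l T) (Mmod P l T)
          (region P l T) (frobAdm P l T) (frobLogvol P l T) (frobΨ P l T) (frobMmod P l T) (unitImage P l T) (ballImage P l T)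
          (thetaDiv P l T))
        (settingPrVolSharpM T.D (logvAnalyticVal_analyticLogvVal (K := T.K)) (tOfIdeleData T.D (ideleDataOf T.D T.isVolumeInputOf))
          (fun u x => tqM T.D (ratChar u) u (natCast_ratChar_mem u) (ideleDataOf T.D T.isVolumeInputOf) x)
          (M P l T) (archPk P l T) (archSub P l T) (Ψ P l T) (act P l T)
          (Mmod P l T) (region P l T) (n P l T) (lat P l T) (sig P l T) (split P l T) (qData P l T)
          (fun u x => tqM_ne_zero T.D (ratChar u) u (natCast_ratChar_mem u) (ideleDataOf T.D T.isVolumeInputOf) x)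
          (GenuineM.finite_ratPlaces_under_S T.D).toFinset
          (fun u x hu => norm_tqM_eq_one_of_not_mem T.D (ratChar u) u (natCast_ratChar_mem u) (ideleDataOf T.D T.isVolumeInputOf) x
            fun hx => hu ((Set.Finite.mem_toFinset _).mpr ⟨x, hx⟩))) 
        (fun _ => Cor312.Setting.qRegion
        (settingPrVolSharpM T.D (logvAnalyticVal_analyticLogvVal (K := T.K)) (tOfIdeleData T.D (ideleDataOf T.D T.isVolumeInputOf))
          (fun u x => tqM T.D (ratChar u) u (natCast_ratChar_mem u) (ideleDataOf T.D T.isVolumeInputOf) x)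
          (M P l T) (archPk P l T) (archSub P l T) (Ψ P l T) (act P l T)
          (Mmod P l T) (region P l T) (n P l T) (lat P l T) (sig P l T) (split P l T) (qData P l T)
          (fun u x => tqM_ne_zero T.D (ratChar u) u (natCast_ratChar_mem u) (ideleDataOf T.D T.isVolumeInputOf) x)
          (GenuineM.finite_ratPlaces_under_S T.D).toFinset
          (fun u x hu => norm_tqM_eq_one_of_not_mem T.D (ratChar u) u (natCast_ratChar_mem u) (ideleDataOf T.D T.isVolumeInputOf) x
            fun hx => hu ((Set.Finite.mem_toFinset _).mpr ⟨x, hx⟩)))) (qK P l T)) → T.Cor312Of)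
    -- [NUM-1.10, content ∧ mixing] [IUTchIV] Thm 1.10 Step (viii)'s squeeze at the admissible points ON THE CONTENT LOCUS and IN the mixing locus
    -- (the negation of abc-iut-s2-p1's off-locus condition of `Conditional.hvol_offMixingLocus_holds`, VERBATIM; same text as p457468)
    (hSqMixCD : ∀ P : NFPoint, P ∈ UP → ∀ l : ℕ, l.Prime → 5 ≤ l →
      -- DEGREE CUT: ONLY at points with `d_mod ≥ 2` — at `d_mod = 1` (`F_mod = ℚ`: ONE place over each prime) every datum is slot-constant and no prime is mixed, so the antecedent below is void
      2 ≤ Cor22.dmod P →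
      Cor22.AdmitsCore P → Cor22.CondP2 P l → Cor22.CondP5 P l → Cor22.CondP6 P l →
      6 * ((1 + 20 * (Cor22.dmod P : ℝ) / l) * (P.logDiff + Cor22.logCondAvoid P {2, l}))
          + 120 * (2 ^ 12 * 3 ^ 3 * 5 * (Cor22.dmod P : ℝ) * l) < Cor22.logQAvoid P {2, l} →
      ¬ (∃ M : Finset ℕ,
        (∀ p : ℕ, p.Prime →
          (¬ ∀ V W : HeightOneSpectrum (𝓞 ↥(IntermediateField.adjoin ℚ ({Cor22.jInv P.x} : Set P.F))),
            V ∈ placesOver _ p → W ∈ placesOver _ p →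
            (if ord _ V (Cor22.jMod P) < 0 ∧ ((2 : ℕ) : 𝓞 _) ∉ V.asIdeal ∧ ((l : ℕ) : 𝓞 _) ∉ V.asIdeal
              then ((-ord _ V (Cor22.jMod P) : ℤ) : ℝ) * logNorm _ V / (localDegree _ V : ℝ) else 0) =
            (if ord _ W (Cor22.jMod P) < 0 ∧ ((2 : ℕ) : 𝓞 _) ∉ W.asIdeal ∧ ((l : ℕ) : 𝓞 _) ∉ W.asIdeal
              then ((-ord _ W (Cor22.jMod P) : ℤ) : ℝ) * logNorm _ W / (localDegree _ W : ℝ) else 0)) → p ∈ M) ∧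
        ((l : ℝ) + 1) / 24 *
            ∑ p ∈ M, ∑ V : placesOver ↥(IntermediateField.adjoin ℚ ({Cor22.jInv P.x} : Set P.F)) p,
              (if ord _ V.1 (Cor22.jMod P) < 0 ∧ ((2 : ℕ) : 𝓞 _) ∉ V.1.asIdeal ∧ ((l : ℕ) : 𝓞 _) ∉ V.1.asIdeal then
                weight _ V.1 * (((-ord _ V.1 (Cor22.jMod P) : ℤ) : ℝ) * logNorm _ V.1 / (localDegree _ V.1 : ℝ))
               else 0) ≤
          ((l : ℝ) + 1) / 4 * (4 * ((Cor22.dmod P : ℝ) - 1) / l * (P.logDiff + Cor22.logCondAvoid P {2, l})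
            + 20 / 3 * Real.log (((2 ^ 12 * 3 ^ 3 * 5 * Cor22.dmod P : ℕ) : ℝ) * l)
              * max 0 (((Nat.primeCounting (2 ^ 12 * 3 ^ 3 * 5 * Cor22.dmod P * l) : ℝ)
                - (2 * (Cor22.dmod P : ℝ) * (P.logDiff + Cor22.logCondAvoid P {2, l}) + Real.log (2 * 3 * 5 * (l : ℝ)))
                  / Real.log 2)))) →
      (((l : ℝ) + 1) / 24 - 1 / (2 * l)) * Cor22.logQAvoid P {2, l} ≤
        ((l : ℝ) + 1) / 4 *
          ((1 + 12 * (Cor22.dmod P : ℝ) / l) * (P.logDiff + Cor22.logCondAvoid P {2, l})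
            + 2 * Real.log l + 52
            + 20 / 3 * Real.log (((2 ^ 12 * 3 ^ 3 * 5 * Cor22.dmod P : ℕ) : ℝ) * (l : ℝ))
              * (Nat.primeCounting (2 ^ 12 * 3 ^ 3 * 5 * Cor22.dmod P * l) : ℝ))
        + ThetaVolumeInput.archLogTheta l)
    : _root_.ABC :=
  abc_of_SH_orNum_M_mix_content_sharpLevelCut M archPk archSub Ψ act Mmod region frobAdm frobLogvol frobΨ frobMmod unitImage ballImage thetaDiv n lat sig split qData qK hNumOffCWS (DegCut.hSqMixC_of_degCut hSqMixCD)

end FamilyM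

end Summit.ABC.IUTFork.Conditional

end
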